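import Mathlib
import Summits.Ventures.HodgeRepro.Tier4.Common.KTypeSpace
import Summits.Ventures.HodgeRepro.Tier4.Common.SettingOfData
import Summits.Ventures.HodgeRepro.Tier4.Line1.IrreducibleSubspace
import Summits.Ventures.HodgeRepro.Tier4.Line1.KernelNondegenerate
import Summits.Ventures.HodgeRepro.Tier4.Line1.LocallyCompactGA
import Summits.Ventures.HodgeRepro.Tier4.Line1.SecondCountableGA
import Summits.Ventures.HodgeRepro.Tier4.Line1.L2InfiniteGA
import Summits.Ventures.HodgeRepro.Tier4.Line1.MaximalFamily
import Summits.Ventures.HodgeRepro.Tier4.Line4.W4SpectralBridge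
import Summits.Ventures.HodgeRepro.Tier4.Line4.W3Reduction
import Summits.Ventures.HodgeRepro.Tier4.Line4.AdaptedONBConj

/-!
# Tier4/Line4/ConjSpanLemmas — conjugation / span lemmas for the basis-free consumer of the L4 wall's reduction

Blind re-derivation cell `pub-hodge-repro`, Tier 4 «prove the step» (README §9–§10), seat t4-L4-p1 (prover, LINE L4,
gen 3; findings S13578 (2), S13597 (2)).  Tree path `lean/Summits/Ventures/HodgeRepro/Tier4/Line4/ConjSpanLemmas.lean`.
Mathlib-level; no literature.

WHAT IS PROVED.  The carrier of the span of a non-empty invariant subspace is itself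
(`coe_span_eq_of_isInvariantSubspace`), conjugation preserves `IsIrrNonzero` (`isIrrNonzero_conj`), conjugation is
semilinear on spans (`span_conj_image_span`, `finiteDimensional_span_conj_image`), and a member of the span of a
CONJUGATE block of an adapted ONB is continuous and orthogonal to the conjugate basis vectors outside the block
(`inner_eq_zero_of_mem_span_conjBlock`).  Consumer: `Line4/W3OfAdapted.lean` (the L4 wall W3″ from basis-free
per-constituent data, on L1-p5's `W3Reduction2.mixed_two_torus_W3_of_spectral_data''`).

Nothing here says anything about the status of the Hodge conjecture for CM abelian varieties, which is NOT proved
(HC_CM is NOT proved by anyone in this repository).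
-/

set_option autoImplicit false

noncomputable section

namespace Summit.Ventures.HodgeRepro.Tier4.Line4

open Summit.Ventures.HodgeRepro.Tier4.Common Summit.Ventures.HodgeRepro.Tier4.Line1 MeasureTheory NumberField
open scoped ComplexConjugate

section Generic

variable {G : Type} [Group G] [TopologicalSpace G] [IsTopologicalGroup G] [MeasurableSpace G]
  [BorelSpace G] (S : RTF.Setting G)

omit [IsTopologicalGroup G] [BorelSpace G] in
/-- The carrier of the span of a non-empty invariant subspace is the subspace itself. -/
theorem coe_span_eq_of_isInvariantSubspace {V : Set (G → ℂ)} (hV : S.IsInvariantSubspace V)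
    (hne : V.Nonempty) : (Submodule.span ℂ V : Set (G → ℂ)) = V := by
  apply Set.Subset.antisymm _ Submodule.subset_span
  intro u hu
  refine Submodule.span_induction (p := fun u _ => u ∈ V) (fun x hx => hx) ?_ ?_ ?_ hu
  · obtain ⟨ψ, hψ⟩ := hne
    have h := hV.smul ψ hψ 0
    have e : (fun x => (0 : ℂ) * ψ x) = (0 : G → ℂ) := by
      funext x
      simp
    rw [e] at h
    exact h
  · intro x y _ _ hx hy
    exact hV.add x hx y hy
  · intro c x _ hx
    exact hV.smul x hx c

omit [IsTopologicalGroup G] [BorelSpace G] in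
/-- The conjugate image of a non-zero irreducible invariant subspace is one. -/
theorem isIrrNonzero_conj {V : Set (G → ℂ)} (h : S.IsIrrNonzero V) :
    S.IsIrrNonzero ((fun ψ : G → ℂ => fun x => conj (ψ x)) '' V) := by
  refine ⟨isInvariantSubspace_conj S h.1, isIrreducible_conj S h.2.1, ?_⟩
  obtain ⟨ψ, hψ, x, hx⟩ := h.2.2
  exact ⟨_, ⟨ψ, hψ, rfl⟩, x, (map_ne_zero (starRingEnd ℂ)).2 hx⟩

omit [Group G] [TopologicalSpace G] [IsTopologicalGroup G] [MeasurableSpace G] [BorelSpace G] in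
/-- Conjugation is semilinear: the span of the conjugate image of a span is the span of the conjugate image. -/
theorem span_conj_image_span (X : Set (G → ℂ)) :
    Submodule.span ℂ ((fun ψ : G → ℂ => fun x => conj (ψ x)) '' (Submodule.span ℂ X : Set (G → ℂ))) =
      Submodule.span ℂ ((fun ψ : G → ℂ => fun x => conj (ψ x)) '' X) := by
  apply le_antisymm
  · rw [Submodule.span_le]
    rintro _ ⟨u, hu, rfl⟩
    refine Submodule.span_induction
      (p := fun u _ => (fun x => conj (u x)) ∈ Submodule.span ℂ ((fun ψ : G → ℂ => fun x => conj (ψ x)) '' X))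
      ?_ ?_ ?_ ?_ hu
    · intro x hx
      exact Submodule.subset_span ⟨x, hx, rfl⟩
    · have e : (fun x => conj ((0 : G → ℂ) x)) = (0 : G → ℂ) := by
        funext x
        simp
      rw [e]
      exact Submodule.zero_mem _
    · intro x y _ _ hx hy
      have e : (fun z => conj ((x + y) z)) = (fun z => conj (x z)) + fun z => conj (y z) := by
        funext z
        simp [map_add]
      rw [e]
      exact Submodule.add_mem _ hx hy
    · intro c x _ hx
      have e : (fun z => conj ((c • x) z)) = conj c • fun z => conj (x z) := by
        funext z
        simp [map_mul]
      rw [e]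
      exact Submodule.smul_mem _ _ hx
  · exact Submodule.span_mono (Set.image_mono Submodule.subset_span)

omit [Group G] [TopologicalSpace G] [IsTopologicalGroup G] [MeasurableSpace G] [BorelSpace G] in
/-- The span of the conjugate image of a finite-dimensional submodule is finite-dimensional. -/
theorem finiteDimensional_span_conj_image (Wk : Submodule ℂ (G → ℂ)) [FiniteDimensional ℂ Wk] :
    FiniteDimensional ℂ
      (Submodule.span ℂ ((fun ψ : G → ℂ => fun x => conj (ψ x)) '' (Wk : Set (G → ℂ)))) := by
  obtain ⟨s, hs⟩ := (Submodule.fg_iff_finiteDimensional Wk).2 inferInstance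
  have h1 : Submodule.span ℂ ((fun ψ : G → ℂ => fun x => conj (ψ x)) '' (Wk : Set (G → ℂ))) =
      Submodule.span ℂ ((fun ψ : G → ℂ => fun x => conj (ψ x)) '' (s : Set (G → ℂ))) := by
    rw [← hs]
    exact span_conj_image_span (s : Set (G → ℂ))
  rw [h1]
  exact FiniteDimensional.span_of_finite ℂ (s.finite_toSet.image _)

end Generic

section Constituents

variable {k : Type} [Field k] [NumberField k] (W : PlaneData k) [MeasurableSpace (GA W)] [BorelSpace (GA W)]
  (R : RTFData W) (μ : Measure (GA W)) [μ.IsHaarMeasure] [R.μT.IsHaarMeasure] [R.μT'.IsHaarMeasure]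
  (DG : Set (GA W)) (fdG : IsFundamentalDomain (rationalPoints W) DG μ) (compG : IsCompact (closure DG))
  (compT : IsCompact (closure R.DT)) (compT' : IsCompact (closure R.DT'))

/-- A member of the span of a CONJUGATE block `(conj ∘ φ) '' F` is continuous and orthogonal to every conjugate
basis vector `conj ∘ φ j`, `j ∉ F`. -/
theorem inner_eq_zero_of_mem_span_conjBlock {τ : ℕ → Set (GA W → ℂ)} {φ : ℕ → GA W → ℂ} {n : ℕ → ℕ}
    (hB : (Setting.ofAdelicData W R μ DG fdG compG compT compT').IsAdaptedONB τ φ n)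
    (F : Finset ℕ) {j : ℕ} (hj : j ∉ F) {u : GA W → ℂ}
    (hu : u ∈ Submodule.span ℂ ((fun j => fun x => conj (φ j x)) '' (F : Set ℕ))) :
    Continuous u ∧
      (Setting.ofAdelicData W R μ DG fdG compG compT compT').inner u (fun x => conj (φ j x)) = 0 := by
  set S := Setting.ofAdelicData W R μ DG fdG compG compT compT' with hS
  have hφj : Continuous (fun x => conj (φ j x)) :=
    Complex.continuous_conj.comp ((hB.inv (n j)).cont _ (hB.mem j))
  refine Submodule.span_induction (p := fun u _ => Continuous u ∧ S.inner u (fun x => conj (φ j x)) = 0)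
    ?_ ?_ ?_ ?_ hu
  · rintro _ ⟨j', hj', rfl⟩
    refine ⟨Complex.continuous_conj.comp ((hB.inv (n j')).cont _ (hB.mem j')), ?_⟩
    rw [inner_conj_conj, hB.orth j' j, if_neg, map_zero]
    intro h
    exact hj (h ▸ Finset.mem_coe.1 hj')
  · exact ⟨continuous_const, S.inner_fun_zero_left _⟩
  · rintro x y _ _ ⟨hxc, hx⟩ ⟨hyc, hy⟩
    refine ⟨hxc.add hyc, ?_⟩
    have e : (x + y : GA W → ℂ) = fun z => x z + y z := rfl
    rw [e, S.inner_add_left_cont hxc hyc hφj, hx, hy, add_zero]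
  · rintro c x _ ⟨hxc, hx⟩
    refine ⟨continuous_const.mul hxc, ?_⟩
    have e : (c • x : GA W → ℂ) = fun z => c * x z := rfl
    rw [e, S.inner_smul_left_cont hxc hφj c, hx, mul_zero]

end Constituents

end Summit.Ventures.HodgeRepro.Tier4.Line4

end
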